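import Summits.PneNP.PneNP.Theses.SymmetryBudget
import Literature.Computability.Complexity.SymmetricCircuit
import HarnessLib.Audit

/-!
# Sketch (ideator 3, crux-ideate round 1) — first lemmas for crux `SymmetryBudget.WindowHam`
(item stmt-PneNP-2143).  Three crux idea cards draw on this file:

* card A `seam-routing-witness`: `seam_reduction` (PROVED: any invariance principle + a
  HAM-fooling family gives the crux BY NAME) and `PortRealisation` (statement: the ordered part
  realises any forced port matching, so HAM-separation is a property of the coloured free part);
* card B `block-rigidity-dichotomy`: `windowHam_of_genHamHard` (PROVED), `SymCanon`,
  `CanonCollapse` (statement: under symmetric window canonisation the crux is literally the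
  general circuit lower bound), `Rigidity` / `RigidityKillsFooling` (statements);
* card C `tail-preserving-gi-to-ham`: `BudgetPreservingReduction`, `squeeze` (PROVED),
  `giPattern` (the specific sibling-crux witness language).
-/

noncomputable section

open Filter Polynomial
open scoped Classical
open Literature.Computability.Complexity
open Summit.PneNP.PneNP.Theses.SymmetryBudget

namespace Summit.PneNP.PneNP.Cruxes.WindowHam.Ideator3

/-! ## Vocabulary aligned with the route decl -/

/-- The route's reading of an `m × m` matrix as a simple graph (inline `Gr`). -/
abbrev Gr (m : ℕ) (x : Fin m × Fin m → Bool) : SimpleGraph (Fin m) :=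
  SimpleGraph.fromRel fun u v => x (u, v) = true

/-- The Boolean function "Gr(x) is Hamiltonian" at size `m` (the crux's target function). -/
abbrev hamFn (m : ℕ) : (Fin m × Fin m → Bool) → Bool :=
  fun x => decide (Gr m x).IsHamiltonian

/-- The symmetry budget `Bud(m,g)` (inline `Bud` = `pointStabiliserBudget`). -/
abbrev Bud (m g : ℕ) : Set (Equiv.Perm (Fin m)) := pointStabiliserBudget m g

/-- Relabelling of an input by a vertex permutation. -/
abbrev relabel {m : ℕ} (ρ : Equiv.Perm (Fin m)) (x : Fin m × Fin m → Bool) :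
    Fin m × Fin m → Bool := fun q => x (ρ q.1, ρ q.2)

/-- Symmetric hardness in the window of an arbitrary family of Boolean functions on matrices
(the crux is `WindowHard hamFn`, see `windowHam_iff`). -/
def WindowHard (f : (m : ℕ) → (Fin m × Fin m → Bool) → Bool) : Prop :=
  ∀ p : Polynomial ℕ, ∃ᶠ m in atTop,
    ¬ HasSymCircuit tcBasis (Bud m (Nat.log 2 m)) (p.eval m) (f m)

/-- The crux, restated over the landed vocabulary: definitional (`Iff.rfl`). -/
theorem windowHam_iff : WindowHam ↔ WindowHard hamFn := Iff.rfl

/-! ## Card A — seam reduction and port realisation -/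

/-- An INVARIANCE PRINCIPLE for window circuits relative to a size-indexed family of binary
relations `E m D` on inputs ("rate-`D` equivalence"): for every polynomial size bound there is
a rate beyond which equivalent inputs are not separated by any Bud(m,⌊log₂ m⌋)-symmetric
threshold circuit of that size.  Instance intended: the entropy game of the sibling line
`Cruxes/WindowBarrier/Lines/entropy-support-dichotomy.lean` (`GameEquiv m (Nat.log 2 m) (D·g)`),
where it is `stub_est ∧ stub_windowSupports ∧ stub_gameInvariance`. -/
def InvariancePrinciple
    (E : (m : ℕ) → ℕ → (Fin m × Fin m → Bool) → (Fin m × Fin m → Bool) → Prop) : Prop :=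
  ∀ p : Polynomial ℕ, ∃ D : ℕ, ∀ (m : ℕ) (C : Circuit (Fin m × Fin m)),
    C.IsOver tcBasis → C.IsSymmetricUnder (Bud m (Nat.log 2 m)) → C.size ≤ p.eval m →
    ∀ x y : Fin m × Fin m → Bool, E m D x y → C.eval x = C.eval y

/-- A HAM-FOOLING FAMILY for `E`: at every rate, infinitely often, an `E`-equivalent pair with
different Hamiltonicity.  (Card A's transfer target `C⁺`; by `PortRealisation` it is a
statement about coloured `⌊log₂ m⌋`-vertex graphs only.) -/
def HamFooling
    (E : (m : ℕ) → ℕ → (Fin m × Fin m → Bool) → (Fin m × Fin m → Bool) → Prop) : Prop :=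
  ∀ D : ℕ, ∃ᶠ m in atTop, ∃ x y : Fin m × Fin m → Bool,
    E m D x y ∧ (Gr m x).IsHamiltonian ∧ ¬ (Gr m y).IsHamiltonian

/-- **Seam reduction (proved).** Any invariance principle plus a HAM-fooling family for the same
equivalence proves the crux `WindowHam` by name. -/
theorem seam_reduction
    (E : (m : ℕ) → ℕ → (Fin m × Fin m → Bool) → (Fin m × Fin m → Bool) → Prop)
    (hI : InvariancePrinciple E) (hF : HamFooling E) : WindowHam := by
  rw [windowHam_iff]
  intro p
  obtain ⟨D, hD⟩ := hI p
  refine (hF D).mono ?_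
  rintro m ⟨x, y, hxy, hx, hy⟩ ⟨C, hB, hsize, hsym, hcomp⟩
  have heval : C.eval x = C.eval y := hD m C hB hsym hsize x y hxy
  have hx' : C.eval x = true := by rw [hcomp x]; exact decide_eq_true hx
  have hy' : C.eval y = false := by rw [hcomp y]; exact decide_eq_false hy
  rw [hx', hy'] at heval
  exact Bool.noConfusion heval

/-- The `i`-th FREE vertex (`m - g + i`) for `g ≤ m`. -/
def freeV {m g : ℕ} (hg : g ≤ m) (i : Fin g) : Fin m :=
  ⟨m - g + i, by omega⟩

/-- The `a`-th PORT: the ordered vertex `a < 2k ≤ m - g`. -/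
def portV {m g k : ℕ} (hk : g + 2 * k ≤ m) (a : Fin (2 * k)) : Fin m :=
  ⟨a, by omega⟩

/-- The PORT GRAPH of a free part: vertices = `2k` ports ⊕ `g` free vertices; port–port edges
are the forced matching `μ`, free–free and free–port edges are read from the input. -/
def portGraph (k g : ℕ) (μ : Equiv.Perm (Fin (2 * k))) (xf : Fin g → Fin g → Bool)
    (xp : Fin g → Fin (2 * k) → Bool) : SimpleGraph (Fin (2 * k) ⊕ Fin g) :=
  SimpleGraph.fromRel fun u v =>
    match u, v with
    | Sum.inl a, Sum.inl b => μ a = b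
    | Sum.inl a, Sum.inr i => xp i a = true
    | Sum.inr i, Sum.inl a => xp i a = true
    | Sum.inr i, Sum.inr j => xf i j = true

/-- **Port realisation (card A, first HAM-specific lemma; provable now, size M).**  For every
fixed-point-free involution `μ` on `2k` ports (`1 ≤ k`, `g + 2k ≤ m`) there is a filling `H` of
the ordered × ordered entries (k vertex-disjoint paths covering ALL ordered vertices, the `a`-th
path joining port `a` to port `μ a`, internal vertices otherwise isolated) such that for every
input `x` agreeing with `H` on the ordered part and having no edges between free vertices and
non-port ordered vertices, `Gr(x)` is Hamiltonian iff the port graph of its free part is.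
Consequence: in a fooling pair the ordered part is a FREE PARAMETER of unbounded complexity,
invisible to any game played on the free part except through the port colours `xp`. -/
def PortRealisation : Prop :=
  ∀ (m g k : ℕ) (hg : g ≤ m) (hk : g + 2 * k ≤ m) (μ : Equiv.Perm (Fin (2 * k))),
    1 ≤ k → (∀ a, μ a ≠ a) → (∀ a, μ (μ a) = a) →
    ∃ H : Fin m × Fin m → Bool, ∀ x : Fin m × Fin m → Bool,
      (∀ u v : Fin m, (u : ℕ) + g < m → (v : ℕ) + g < m → x (u, v) = H (u, v)) →
      (∀ u v : Fin m, 2 * k ≤ (u : ℕ) → (u : ℕ) + g < m → m ≤ (v : ℕ) + g →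
          x (u, v) = false ∧ x (v, u) = false) →
      ((Gr m x).IsHamiltonian ↔
        (portGraph k g μ (fun i j => x (freeV hg i, freeV hg j))
          (fun i a => x (freeV hg i, portV hk a) || x (portV hk a, freeV hg i))).IsHamiltonian)

/-! ## Card B — rigidity dichotomy and canonisation collapse -/

/-- HAM (as the matrix function of the crux) has no polynomial-size GENERAL threshold circuits,
infinitely often — `HAMCIRCUIT ∉ PPoly` in the crux's own encoding. -/
def GenHamHard : Prop :=
  ∀ p : Polynomial ℕ, ∃ᶠ m in atTop, ¬ ∃ C : Circuit (Fin m × Fin m),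
    C.IsOver tcBasis ∧ C.size ≤ p.eval m ∧ C.Computes (hamFn m)

/-- **The trivial direction (proved):** a general lower bound gives the symmetric one. -/
theorem windowHam_of_genHamHard (h : GenHamHard) : WindowHam := by
  rw [windowHam_iff]
  intro p
  refine (h p).mono ?_
  rintro m hm ⟨C, hB, hsize, -, hcomp⟩
  exact hm ⟨C, hB, hsize, hcomp⟩

/-- **Symmetric window canonisation** (`TAME` of the sibling crux, per output bit): a
Bud-invariant canonical form `can x = x ∘ (π_x × π_x)`, `π_x ∈ Bud(m,⌊log₂ m⌋)`, each of whose
`m²` output bits has a Bud-symmetric threshold circuit of size `q(m)`. -/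
def SymCanon : Prop :=
  ∃ q : Polynomial ℕ, ∀ m : ℕ,
    ∃ can : (Fin m × Fin m → Bool) → (Fin m × Fin m → Bool),
      (∀ x, ∃ π ∈ Bud m (Nat.log 2 m), can x = relabel π x) ∧
      (∀ x, ∀ ρ ∈ Bud m (Nat.log 2 m), can (relabel ρ x) = can x) ∧
      (∀ q₀ : Fin m × Fin m,
        HasSymCircuit tcBasis (Bud m (Nat.log 2 m)) (q.eval m) (fun x => can x q₀))

/-- **Canonisation collapse (card B, first lemma; `←` is `windowHam_of_genHamHard`, `→` is the
composition lemma "general circuit ∘ symmetric canoniser is symmetric", size M).**  Under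
`SymCanon` the crux is EXACTLY the general circuit lower bound for HAM: no symmetric-circuit
lever can then exist, and the route `SymmetryBudget` coincides with route `Circuit`. -/
def CanonCollapse : Prop := SymCanon → (WindowHam ↔ GenHamHard)

/-- **Rigidity of an equivalence at some rate:** beyond rate `D₀`, `E`-equivalent inputs are
Bud-isomorphic (for the entropy game: "O(1) block moves + O(g/log g) pebbles + counting identify
every ⌊log₂ m⌋-vertex coloured graph" — conjecture `BlockRigidity` of card B). -/
def Rigidity
    (E : (m : ℕ) → ℕ → (Fin m × Fin m → Bool) → (Fin m × Fin m → Bool) → Prop) : Prop :=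
  ∃ D₀ : ℕ, ∀ᶠ m in atTop, ∀ x y : Fin m × Fin m → Bool,
    E m D₀ x y → ∃ ρ ∈ Bud m (Nat.log 2 m), y = relabel ρ x

/-- The dichotomy edge (statement; proof = Hamiltonicity is invariant under relabelling and
`E` antitone in the rate): a rigid equivalence has no HAM-fooling family, so every line through
`seam_reduction` with that `E` is dead — and if moreover the Spoiler strategies are
constructive (`SymCanon`), `CanonCollapse` applies. -/
def RigidityKillsFooling : Prop :=
  ∀ E : (m : ℕ) → ℕ → (Fin m × Fin m → Bool) → (Fin m × Fin m → Bool) → Prop,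
    (∀ m D D' x y, D ≤ D' → E m D' x y → E m D x y) → Rigidity E → ¬ HamFooling E

/-! ## Card C — the squeeze through a tail-preserving reduction -/

/-- Monotonicity of evaluation of an `ℕ`-polynomial (helper). -/
theorem eval_mono_nat (p : Polynomial ℕ) {a b : ℕ} (h : a ≤ b) : p.eval a ≤ p.eval b := by
  rw [Polynomial.eval_eq_sum_range, Polynomial.eval_eq_sum_range]
  exact Finset.sum_le_sum fun i _ => Nat.mul_le_mul_left _ (Nat.pow_le_pow_left h i)

/-- **Budget-preserving (tail-preserving) reduction of a family `f` to HAM:** a size map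
`m ↦ m' ≥ m` of polynomial growth such that Bud-symmetric HAM circuits at `(m', ⌊log₂ m'⌋)`
yield Bud-symmetric circuits for `f m` at `(m, ⌊log₂ m⌋)` with polynomial overhead.  (To be
DISCHARGED by an equivariant gadget reduction free ↦ O(1) free, ordered ↦ poly ordered, plus
the composition lemma for symmetric circuits; FO-interpretations of dimension ≥ 2 do NOT
qualify — they move `g·m^{d-1}` vertices out of the tail.) -/
def BudgetPreservingReduction (f : (m : ℕ) → (Fin m × Fin m → Bool) → Bool) : Prop :=
  ∃ (r : Polynomial ℕ) (m' : ℕ → ℕ), (∀ m, m ≤ m' m) ∧ (∀ m, m' m ≤ r.eval m) ∧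
    ∀ m s, HasSymCircuit tcBasis (Bud (m' m) (Nat.log 2 (m' m))) s (hamFn (m' m)) →
      HasSymCircuit tcBasis (Bud m (Nat.log 2 m)) (s + r.eval m) (f m)

/-- **The squeeze (proved):** a budget-preserving reduction of `f` to HAM and symmetric window
hardness of `f` give `WindowHam` by name. -/
theorem squeeze (f : (m : ℕ) → (Fin m × Fin m → Bool) → Bool)
    (hR : BudgetPreservingReduction f) (hf : WindowHard f) : WindowHam := by
  rw [windowHam_iff]
  obtain ⟨r, m', hle, hm'r, hred⟩ := hR
  intro p
  have htend : Tendsto m' atTop atTop :=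
    tendsto_atTop_mono hle tendsto_id
  have key : ∃ᶠ m in atTop,
      ¬ HasSymCircuit tcBasis (Bud (m' m) (Nat.log 2 (m' m))) (p.eval (m' m)) (hamFn (m' m)) := by
    refine (hf (p.comp r + r)).mono ?_
    intro m hm hsym
    apply hm
    have h1 := hred m (p.eval (m' m)) hsym
    refine h1.mono ?_
    rw [Polynomial.eval_add, Polynomial.eval_comp]
    exact Nat.add_le_add_right (eval_mono_nat p (hm'r m)) _
  exact htend.frequently key

/-- The sibling crux's isomorphism witness as a matrix function: "the free part (last
`g = ⌊log₂ m⌋` vertices) induces a graph isomorphic to the PATTERN induced on the first `g`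
ordered vertices" (in P by Babai–Luks / Luks for bounded degree; junk `false` when `2g > m`). -/
def giPattern (m : ℕ) (x : Fin m × Fin m → Bool) : Bool :=
  if h : 2 * Nat.log 2 m ≤ m then
    decide (∃ β : Fin (Nat.log 2 m) ≃ Fin (Nat.log 2 m), ∀ i j : Fin (Nat.log 2 m),
      (Gr m x).Adj (freeV (Nat.le_of_add_right_le (by omega : Nat.log 2 m + Nat.log 2 m ≤ m)) i)
                   (freeV (Nat.le_of_add_right_le (by omega : Nat.log 2 m + Nat.log 2 m ≤ m)) j) ↔
      (Gr m x).Adj ⟨β i, by omega⟩ ⟨β j, by omega⟩)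
  else false

/-- Card C's concrete target: `WindowHam` follows from symmetric window hardness of the
GI-to-ordered-pattern language and its budget-preserving reduction to HAM (instance of
`squeeze`). -/
theorem windowHam_of_giPattern (hR : BudgetPreservingReduction giPattern)
    (hGI : WindowHard giPattern) : WindowHam :=
  squeeze giPattern hR hGI

end Summit.PneNP.PneNP.Cruxes.WindowHam.Ideator3

end
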